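import Summits.QuantumFields.YangMills.Theorems.BalabanUVNodesN15KingModelNestedSliceSums
import Summits.QuantumFields.YangMills.Theorems.BalabanUVNodesN15KingModelGraphPowerCountingEngine

/-!
# BalabanUVNodes ∕ N15 — THE KING-MODEL RUNG (PART Γ-b): PROPOSITION 3.6's POWER COUNTING FOR GENERAL GRAPHS — THE ORDERINGS AND THE SLICES: the monotone
# slice tuples of an ordering ARE part Ι-g's nested slice sums, and the GENERIC ASSEMBLY «Σ over all slice assignments of the majorant graph values
# ≤ Γ·C^m·c^n·(Σ_π Π_i (1 − L^{−D_i})^{−1})·Π q» under POSITIVE DEGREES ALONG EVERY ORDERING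
# (Track A, DAG node N15 = NE2; FAN-OUT v1.1 §N15 s3 «KING-MODEL RUNG … NE2's analogue DECIDED in the model»)

HONEST FRAMING.  Count-neutral (cell `pub-ymgap`, seat `pub-ymgap-dag-n15-e` g27; `--supports stmt-QuantumFields-27366 --as helper` = K3⁸
`SpineGivenEndpointR13SepCoPHV`).  TEMPLATE LITERATURE: C. King, *The U(1) Higgs model. I. The continuum limit*, Commun. Math. Phys. **102** (1986) 649–677
[King1986], proof of Proposition 3.6, pp. 663–664.  Part Γ-a typed the graph half at a fixed slice assignment (spanning-forest certificate ⇒ loop lines by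
sup, tree lines by line sums) and the sum over orderings (3.58); part Ι-g typed the slice sums (3.69)–(3.70) iterated along an ordering as NESTED sums over
`j_1 ≤ … ≤ j_m`.  THIS FILE identifies the two (the sum over assignments `j : lines → slices` compatible with an ordering IS the nested sum) and assembles the
generic size half of (3.56): slice-indexed majorants with (3.63)-type sups and (3.68)-type vertex sums, one certificate per ordering with positive partial
degrees ⇒ a bound UNIFORM IN THE NUMBER OF SLICES.  Generic (finite sorts, real exponents); part Γ-c puts King's `A = 0` propagators on it by name.  NOT
Bałaban's non-abelian `G(U)` of [B9]; NOT a node discharge; nothing continuum ∕ ℝ⁴ ∕ OS ∕ mass-gap ∕ Clay.  0 `sorry`; standard axioms.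

THE PRINT.  p. 663 [PDF 15]: *«The resulting product of sums is multiplied out and rewritten as a sum over orderings l = {l(1), …, l(m)} of the m internal
lines. This is followed by a sum over integers {j_{l(p)}}, p = 1, …, m, compatible with this ordering, meaning j_{l(1)} ≤ j_{l(2)} ≤ … ≤ j_{l(m)} (3.58). …
Σ_l Σ_{j compatible with l} E^{(k)}(H(j)) (3.59)»*; p. 664 [PDF 16]: *«Combining this factor with the power of L^{j_{l(1)}−k} already present from the propagator
on l(1) … we get altogether the exponent D(H₁). If l(2) ∈ S^c, we can sum over j_{l(1)} ≤ j_{l(2)}, since D(H₁) > 0 (3.69) … We continue doing this … (3.70) …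
For γ small enough, D(H_i) − γ > 0 and we continue the process, eventually shrinking H to one point x. The final sum over j is then bounded by C, and the
sum over x by |□′|. … Finally, there is a sum over orderings of the lines, again depending only on n̄.»*

WHAT THIS FILE PROVES (namespace `Summit.QuantumFields.YangMills.BalabanUVNodes.N15KingModelRung.Curved`; slice lengths `s_c = L^c·eps L K = L^cη`).
* §1 `sliceProd L K E j = Π_p s_{j_p}^{E_p}` (position `p = 0` = the finest line); `monotone_snoc_iff`, `sum_fin_ite_le_eq_sum_range`; ★★
  **`sum_monotone_sliceProd_eq`** — `Σ_{j : Fin m → Fin K, j monotone, j ≤ b} Π_p s_{j_p}^{E_p} = nestedSliceSum L K [E_{m−1}, …, E_0] b` (`b < K`; induction on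
  `m` peeling the coarsest line by `Fin.snocEquiv`); `sum_monotone_sliceProd_eq_top` (`b = K − 1`, no constraint).
* §2 `orderExps dV e π F` (the exponent of position `p`: `e_{π p} + dV·[π p is a tree line of F]`), `orderList` (coarsest first), `lineConstants_eq` (loop sups
  `Cst·s^{e}` × tree sums `Cst·cV·s^{e+dV}` `= Cst^m·cV^n·sliceProd (orderExps …) (j ∘ π)`), `graphValLS_nonneg'`; ★★★ **`sum_graphValLS_slices_le`** —
  THE GENERIC SIZE HALF: for a flat graph on vertices `Fin (n+1)` with `m` numbered lines carrying slice-indexed nonnegative majorants `P_ℓ(c)` with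
  `P_ℓ(c) ≤ Cst·s_c^{e_ℓ}` and vertex sums `≤ Cst·cV·s_c^{e_ℓ+dV}` (both orientations), one-vertex majorants (root-placed `L¹` factor `≤ Γ`, sups `q_υ`), and
  certificates `cert π` with `PosDegrees (orderList dV e π (cert π))` for EVERY ordering `π`:
  `Σ_{j : Fin m → Fin K} graphValLS ω src tgt (P∘j) vtx p ≤ Γ·Cst^m·cV^n·(Σ_π degConst L (orderList … π (cert π)))·Π_{υ ≠ υ₀} q_υ` — uniformly in `K`.

HONEST SCOPE.  (a) Generic: the positivity of the degrees along every ordering is a HYPOTHESIS (King: guaranteed by §3.5's renormalised graphs and Thm 3.5 —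
NOT typed), the certificates are user data (Kruskal's forest of `π` gives King's `D(H_i)`; any forest is admissible); the constant carries the factor
`Σ_π degConst ≤ m!·max` («a sum over orderings … depending only on n̄»).  (b) Slices `0 ≤ c < K` (King's `S`; the `S^c` slices of the fine run and the rate
(3.73) are part Γ-d).  (c) Vertex exponent extras («any extra factors η at x and y») are to be pre-assigned to lines by the user (not modelled separately).
Locators: [King1986] (3.58)–(3.59) p.663, (3.66) p.663 (foot), (3.67)–(3.70) p.664.
-/
noncomputable section

namespace Summit.QuantumFields.YangMills.BalabanUVNodes.N15KingModelRung.Curved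

open scoped BigOperators
open Finset
open Literature.MathematicalPhysics.QuantumFieldTheory.King1986.ContinuumLimit (eps)
open Summit.QuantumFields.YangMills.BalabanUVNodes.N15KingModelRung.Graph

variable (L : ℕ)

/-! ## §1 The monotone slice tuples of an ordering ARE the nested slice sums -/

section MonotoneTuples

/-- **the product of slice powers along an ordered tuple of lines**: `Π_p (L^{j_p}η)^{E_p}` (`η = L^{−K}`; position `p = 0` = the finest line `l(1)`).
[cite: King1986, (3.58)–(3.59) p.663, (3.69)–(3.70) p.664] -/
def sliceProd (K : ℕ) {m : ℕ} (E : Fin m → ℝ) (j : Fin m → Fin K) : ℝ :=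
  ∏ p, ((L : ℝ) ^ ((j p : ℕ)) * eps L K) ^ E p

omit L in
/-- `Fin.snoc j′ c` is monotone iff `j′` is monotone and stays below `c`. [folklore] -/
theorem monotone_snoc_iff {m : ℕ} {β : Type*} [Preorder β] (j' : Fin m → β) (c : β) :
    Monotone (Fin.snoc j' c : Fin (m + 1) → β) ↔ Monotone j' ∧ ∀ p, j' p ≤ c := by
  constructor
  · intro h
    refine ⟨fun a b hab => ?_, fun p => ?_⟩
    · have h1 := h (Fin.castSucc_le_castSucc_iff.2 hab)
      rwa [Fin.snoc_castSucc, Fin.snoc_castSucc] at h1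
    · have h1 := h (Fin.le_last (Fin.castSucc p) : Fin.castSucc p ≤ Fin.last m)
      rwa [Fin.snoc_castSucc, Fin.snoc_last] at h1
  · rintro ⟨hj, hc⟩ a b hab
    rcases Fin.eq_castSucc_or_eq_last b with ⟨b', rfl⟩ | rfl
    · rcases Fin.eq_castSucc_or_eq_last a with ⟨a', rfl⟩ | rfl
      · rw [Fin.snoc_castSucc, Fin.snoc_castSucc]
        exact hj (Fin.castSucc_le_castSucc_iff.1 hab)
      · exact absurd hab (not_le.2 (Fin.castSucc_lt_last b'))
    · rw [Fin.snoc_last]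
      rcases Fin.eq_castSucc_or_eq_last a with ⟨a', rfl⟩ | rfl
      · rw [Fin.snoc_castSucc]; exact hc a'
      · rw [Fin.snoc_last]

omit L in
/-- a finite sum over `Fin K` restricted to `c ≤ b < K` is the sum over `range (b+1)`. [folklore] -/
theorem sum_fin_ite_le_eq_sum_range {M : Type*} [AddCommMonoid M] {K b : ℕ} (hb : b < K) (g : ℕ → M) :
    ∑ c : Fin K, (if (c : ℕ) ≤ b then g c else 0) = ∑ c ∈ Finset.range (b + 1), g c := by
  rw [Fin.sum_univ_eq_sum_range (fun c => if c ≤ b then g c else 0) K, ← sum_filter]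
  congr 1
  ext c
  simp only [mem_filter, mem_range]
  omega

/-- ★★ **THE MONOTONE SLICE TUPLES OF AN ORDERING ARE PART Ι-g's NESTED SLICE SUMS**: for exponents `E_p` by position (finest first) and `b < K`,
`Σ_{j : Fin m → Fin K, j monotone, j ≤ b} Π_p (L^{j_p}η)^{E_p} = nestedSliceSum L K [E_{m−1}, …, E_0] b` — King's *«sum over integers {j_{l(p)}} compatible
with this ordering, meaning j_{l(1)} ≤ j_{l(2)} ≤ … ≤ j_{l(m)}»* IS the iterated sum of (3.69)–(3.70) (induction on `m`, peeling the coarsest line `j_m`: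
`j = (j′, j_m)` by `Fin.snocEquiv`, `j` monotone and `≤ b` iff `j_m ≤ b`, `j′` monotone and `≤ j_m`). [cite: King1986, (3.58) p.663, (3.69)–(3.70) p.664] -/
theorem sum_monotone_sliceProd_eq (K : ℕ) : ∀ (m : ℕ) (E : Fin m → ℝ) (b : ℕ), b < K →
    ∑ j : Fin m → Fin K, (if Monotone j ∧ ∀ p, ((j p : ℕ)) ≤ b then sliceProd L K E j else 0)
      = nestedSliceSum L K (List.ofFn fun p : Fin m => E (Fin.rev p)) b
  | 0, E, b, _ => by
      have hmono : ∀ j : Fin 0 → Fin K, (Monotone j ∧ ∀ p, ((j p : ℕ)) ≤ b) := fun j => ⟨fun a => Fin.elim0 a, fun p => Fin.elim0 p⟩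
      simp [hmono, sliceProd, nestedSliceSum]
  | m + 1, E, b, hb => by
      classical
      rw [List.ofFn_succ]
      have htail : (List.ofFn fun p : Fin m => E (Fin.rev p.succ)) = List.ofFn fun p : Fin m => (fun q : Fin m => E q.castSucc) (Fin.rev p) := by
        congr 1; funext p; rw [Fin.rev_succ]
      rw [htail, Fin.rev_zero]
      show _ = ∑ c ∈ Finset.range (b + 1), ((L : ℝ) ^ c * eps L K) ^ E (Fin.last m)
          * nestedSliceSum L K (List.ofFn fun p : Fin m => (fun q : Fin m => E q.castSucc) (Fin.rev p)) c
      -- peel the coarsest line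
      rw [← (Fin.snocEquiv fun _ => Fin K).sum_comp, Fintype.sum_prod_type]
      rw [← sum_fin_ite_le_eq_sum_range hb]
      refine sum_congr rfl fun c _ => ?_
      have hsn : ∀ j' : Fin m → Fin K, ((Fin.snocEquiv fun _ => Fin K) (c, j') : Fin (m + 1) → Fin K) = Fin.snoc j' c := fun _ => rfl
      simp_rw [hsn]
      by_cases hcb : (c : ℕ) ≤ b
      · rw [if_pos hcb, ← sum_monotone_sliceProd_eq K m (fun q => E q.castSucc) c c.isLt, mul_sum]
        refine sum_congr rfl fun j' _ => ?_
        have hiff : (Monotone (Fin.snoc j' c : Fin (m + 1) → Fin K) ∧ ∀ p, (((Fin.snoc j' c : Fin (m + 1) → Fin K) p : ℕ)) ≤ b)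
            ↔ (Monotone j' ∧ ∀ p, ((j' p : ℕ)) ≤ c) := by
          rw [monotone_snoc_iff]
          constructor
          · rintro ⟨⟨hj, hjc⟩, -⟩
            exact ⟨hj, fun p => hjc p⟩
          · rintro ⟨hj, hjc⟩
            refine ⟨⟨hj, fun p => hjc p⟩, fun p => ?_⟩
            rcases Fin.eq_castSucc_or_eq_last p with ⟨p', rfl⟩ | rfl
            · rw [Fin.snoc_castSucc]; exact (hjc p').trans hcb
            · rw [Fin.snoc_last]; exact hcb
        rw [if_congr hiff rfl rfl]
        split_ifs with h
        · -- the product splits off its last factor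
          unfold sliceProd
          rw [Fin.prod_univ_castSucc, Fin.snoc_last]
          simp_rw [Fin.snoc_castSucc]
          ring
        · rw [mul_zero]
      · rw [if_neg hcb]
        refine sum_eq_zero fun j' _ => ?_
        rw [if_neg]
        rintro ⟨-, hle⟩
        have h1 := hle (Fin.last m)
        rw [Fin.snoc_last] at h1
        exact hcb h1

/-- the unconstrained form at `b = K − 1` (every slice index is `≤ K − 1`): `Σ_{j monotone} Π_p (L^{j_p}η)^{E_p} = nestedSliceSum L K [E_{m−1}, …, E_0] (K − 1)`.
[cite: King1986, (3.58) p.663, (3.70) p.664] -/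
theorem sum_monotone_sliceProd_eq_top {K : ℕ} (hK : 1 ≤ K) (m : ℕ) (E : Fin m → ℝ) :
    ∑ j : Fin m → Fin K, (if Monotone j then sliceProd L K E j else 0)
      = nestedSliceSum L K (List.ofFn fun p : Fin m => E (Fin.rev p)) (K - 1) := by
  classical
  rw [← sum_monotone_sliceProd_eq L K m E (K - 1) (by omega)]
  refine sum_congr rfl fun j _ => ?_
  have h : (Monotone j ∧ ∀ p, ((j p : ℕ)) ≤ K - 1) ↔ Monotone j :=
    ⟨fun h => h.1, fun h => ⟨h, fun p => by have := (j p).isLt; omega⟩⟩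
  rw [if_congr h rfl rfl]

end MonotoneTuples

/-! ## §2 The power counting under positive degrees along every ordering — generic assembly -/

section Assembly
variable {S : Type*} [Fintype S] [Nonempty S] {Υ : Type*} [Fintype Υ] [DecidableEq Υ]
variable {n m : ℕ} {src tgt : Fin m → Fin (n + 1)}

omit L in
/-- **THE EXPONENTS ALONG AN ORDERING** `π` (position `p` = King's line `l(p+1)`, finest first) for a certificate `F`: the line's own power `e_ℓ` of the
slice length ((3.63): `2 − d`, `1 − d`), PLUS `dV` (`= d + 1`, the vertex sum (3.68)) when the line is a TREE line of `F` — so that the partial sums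
`E_0 + … + E_{i−1}` are King's degrees `D(H_i)` (3.66) when `F` is the Kruskal forest of `π`. [cite: King1986, (3.66)–(3.68) p.664] -/
def orderExps (dV : ℝ) (e : Fin m → ℝ) (π : Equiv.Perm (Fin m)) (F : ForestCert n src tgt) : Fin m → ℝ :=
  fun p => e (π p) + if π p ∈ (univ : Finset (Fin n)).image F.tl then dV else 0

omit L in
/-- the same exponents listed from the COARSEST line down (part Ι-g's convention: the head's partial sum is `D(H_m)`). [cite: King1986, (3.66) p.664] -/
def orderList (dV : ℝ) (e : Fin m → ℝ) (π : Equiv.Perm (Fin m)) (F : ForestCert n src tgt) : List ℝ :=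
  List.ofFn fun p : Fin m => orderExps dV e π F (Fin.rev p)

/-- the bookkeeping of the constants and exponents at a fixed assignment: loop lines `Cst·s^{e}`, tree lines `Cst·cV·s^{e+dV}` multiply to
`Cst^m·cV^n·Π_p s_{j(π p)}^{E_p}`. [cite: King1986, (3.66)–(3.68) p.664] -/
theorem lineConstants_eq (K : ℕ) (F : ForestCert n src tgt) (π : Equiv.Perm (Fin m)) (Cst cV dV : ℝ) (e : Fin m → ℝ) (j : Fin m → Fin K) :
    (∏ ℓ ∈ ((univ : Finset (Fin n)).image F.tl)ᶜ, Cst * ((L : ℝ) ^ ((j ℓ : ℕ)) * eps L K) ^ e ℓ)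
        * ∏ i, Cst * cV * ((L : ℝ) ^ ((j (F.tl i) : ℕ)) * eps L K) ^ (e (F.tl i) + dV)
      = Cst ^ m * cV ^ n * sliceProd L K (orderExps dV e π F) (j ∘ ⇑π) := by
  classical
  set T : Finset (Fin m) := (univ : Finset (Fin n)).image F.tl with hT
  set E' : Fin m → ℝ := fun ℓ => e ℓ + if ℓ ∈ T then dV else 0 with hE'
  have hTc : T.card = n := by rw [hT, card_image_of_injective _ F.tl_injective, card_univ, Fintype.card_fin]
  have h1 : ∏ i, Cst * cV * ((L : ℝ) ^ ((j (F.tl i) : ℕ)) * eps L K) ^ (e (F.tl i) + dV)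
      = ∏ ℓ ∈ T, cV * (Cst * ((L : ℝ) ^ ((j ℓ : ℕ)) * eps L K) ^ E' ℓ) := by
    rw [hT, prod_image fun i _ i' _ h => F.tl_injective h]
    refine prod_congr rfl fun i _ => ?_
    have hi : F.tl i ∈ T := mem_image_of_mem _ (mem_univ i)
    rw [hE']; dsimp only; rw [if_pos hi]; ring
  have h2 : ∏ ℓ ∈ Tᶜ, Cst * ((L : ℝ) ^ ((j ℓ : ℕ)) * eps L K) ^ e ℓ = ∏ ℓ ∈ Tᶜ, Cst * ((L : ℝ) ^ ((j ℓ : ℕ)) * eps L K) ^ E' ℓ :=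
    prod_congr rfl fun ℓ hℓ => by rw [hE']; dsimp only; rw [if_neg (mem_compl.1 hℓ), add_zero]
  have h3 : sliceProd L K (orderExps dV e π F) (j ∘ ⇑π) = ∏ ℓ, ((L : ℝ) ^ ((j ℓ : ℕ)) * eps L K) ^ E' ℓ := by
    unfold sliceProd orderExps
    exact prod_comp_perm_eq π (fun ℓ => ((L : ℝ) ^ ((j ℓ : ℕ)) * eps L K) ^ E' ℓ)
  have hA : ∏ ℓ ∈ T, cV * (Cst * ((L : ℝ) ^ ((j ℓ : ℕ)) * eps L K) ^ E' ℓ) = cV ^ n * ∏ ℓ ∈ T, Cst * ((L : ℝ) ^ ((j ℓ : ℕ)) * eps L K) ^ E' ℓ := by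
    rw [prod_mul_distrib, prod_const, hTc]
  have hB : (∏ ℓ ∈ Tᶜ, Cst * ((L : ℝ) ^ ((j ℓ : ℕ)) * eps L K) ^ E' ℓ) * (∏ ℓ ∈ T, Cst * ((L : ℝ) ^ ((j ℓ : ℕ)) * eps L K) ^ E' ℓ)
      = ∏ ℓ, Cst * ((L : ℝ) ^ ((j ℓ : ℕ)) * eps L K) ^ E' ℓ := by
    rw [mul_comm]; exact prod_mul_prod_compl T _
  have hC : ∏ ℓ, Cst * ((L : ℝ) ^ ((j ℓ : ℕ)) * eps L K) ^ E' ℓ = Cst ^ m * ∏ ℓ, ((L : ℝ) ^ ((j ℓ : ℕ)) * eps L K) ^ E' ℓ := by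
    rw [prod_mul_distrib, prod_const, card_univ, Fintype.card_fin]
  rw [h1, h2, h3, hA, mul_left_comm, hB, hC]
  ring

omit [Nonempty S] [DecidableEq Υ] in
/-- the majorant graph value with nonnegative data is nonnegative. [folklore] -/
theorem graphValLS_nonneg' {Λ V : Type*} [Fintype Λ] [Fintype V] [DecidableEq V] (src' tgt' : Λ → V) (vtx : Υ → V) {ω : ℝ} (hω : 0 ≤ ω)
    (P : Λ → S → S → ℝ) (hP : ∀ ℓ x y, 0 ≤ P ℓ x y) (p : Υ → S → ℝ) (hp : ∀ υ x, 0 ≤ p υ x) :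
    0 ≤ graphValLS ω src' tgt' P vtx p :=
  sum_nonneg fun _ _ => mul_nonneg (pow_nonneg hω _) (mul_nonneg (prod_nonneg fun _ _ => hP _ _ _) (prod_nonneg fun _ _ => hp _ _))

/-- ★★★ **THE POWER COUNTING UNDER POSITIVE DEGREES ALONG EVERY ORDERING — GENERIC ASSEMBLY (the size half of (3.56) before King's objects).**  A flat
graph on the numbered vertices `0, …, n` with `m` numbered internal lines; every line `ℓ` carries a SLICE-INDEXED family of nonnegative majorants
`P_ℓ(c)` (`c < K`, slice length `s_c = L^cη`) with the sup `P_ℓ(c) ≤ Cst·s_c^{e_ℓ}` ((3.63)) and both vertex sums `Σ_a ω·P_ℓ(c)(y, a), Σ_a ω·P_ℓ(c)(a, y) ≤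
Cst·cV·s_c^{e_ℓ+dV}` ((3.68)); one-vertex majorants with a root-placed `L¹` factor `υ₀` (`Σ ω·p_{υ₀} ≤ Γ`) and sups `q_υ`; and FOR EVERY ORDERING `π` a
spanning-forest certificate `cert π` whose exponent list `orderList dV e π (cert π)` has POSITIVE PARTIAL DEGREES.  THEN the sum over ALL slice assignments
of the majorant graph values is bounded UNIFORMLY IN `K`:
`Σ_{j : Fin m → Fin K} 𝔼(H(j)) ≤ Γ·Cst^m·cV^n·(Σ_π degConst L (orderList … π …))·Π_{υ ≠ υ₀} q_υ`
— (3.58) splits the assignments by orderings (part Γ-a §3), each `(π, j)` is bounded by part Γ-a's `graphValLS_le_of_forestCert` with loop sups `Cst·s^{e}`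
and tree sums `Cst·cV·s^{e+dV}` (= `Cst^m cV^n·Π_p s_{j_p}^{E_p}`, `lineConstants_eq`), the monotone tuples are part Ι-g's nested sums (§1) and
`nestedSliceSum_le_degConst` closes under `PosDegrees` — «The final sum over j is then bounded by C … Finally, there is a sum over orderings of the lines».
[cite: King1986, (3.58)–(3.59) p.663, (3.66)–(3.70) p.664] -/
theorem sum_graphValLS_slices_le (hL : 2 ≤ L) {K : ℕ} (hK : 1 ≤ K) (vtx : Υ → Fin (n + 1)) {ω : ℝ} (hω : 0 ≤ ω)
    (P : Fin m → Fin K → S → S → ℝ) (hP0 : ∀ ℓ c x y, 0 ≤ P ℓ c x y) {Cst cV : ℝ} (hCst : 0 ≤ Cst) (hcV : 0 ≤ cV) (dV : ℝ) (e : Fin m → ℝ)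
    (hsup : ∀ ℓ c x y, P ℓ c x y ≤ Cst * ((L : ℝ) ^ ((c : ℕ)) * eps L K) ^ e ℓ)
    (hrow : ∀ ℓ c y, ∑ a, ω * P ℓ c y a ≤ Cst * cV * ((L : ℝ) ^ ((c : ℕ)) * eps L K) ^ (e ℓ + dV))
    (hcol : ∀ ℓ c y, ∑ a, ω * P ℓ c a y ≤ Cst * cV * ((L : ℝ) ^ ((c : ℕ)) * eps L K) ^ (e ℓ + dV))
    (p : Υ → S → ℝ) (hp0 : ∀ υ x, 0 ≤ p υ x) (υ₀ : Υ) (hυ₀ : vtx υ₀ = 0) {Γ : ℝ} (hΓ : ∑ x, ω * p υ₀ x ≤ Γ)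
    (q : Υ → ℝ) (hq : ∀ υ, υ ≠ υ₀ → ∀ x, p υ x ≤ q υ)
    (cert : Equiv.Perm (Fin m) → ForestCert n src tgt) (hpos : ∀ π, PosDegrees (orderList dV e π (cert π))) :
    ∑ j : Fin m → Fin K, graphValLS ω src tgt (fun ℓ => P ℓ (j ℓ)) vtx p
      ≤ Γ * (Cst ^ m * cV ^ n * (∑ π : Equiv.Perm (Fin m), degConst L (orderList dV e π (cert π))) * ∏ υ ∈ univ.erase υ₀, q υ) := by
  classical
  obtain ⟨x₀⟩ := ‹Nonempty S›
  have hΓ0 : 0 ≤ Γ := (sum_nonneg fun x _ => mul_nonneg hω (hp0 _ _)).trans hΓ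
  have hq0 : 0 ≤ ∏ υ ∈ univ.erase υ₀, q υ := prod_nonneg fun υ hυ => (hp0 υ x₀).trans (hq υ (ne_of_mem_erase hυ) x₀)
  set B : ℝ := Γ * (Cst ^ m * cV ^ n * ∏ υ ∈ univ.erase υ₀, q υ) with hB
  have hB0 : 0 ≤ B := mul_nonneg hΓ0 (mul_nonneg (mul_nonneg (pow_nonneg hCst _) (pow_nonneg hcV _)) hq0)
  -- per `(π, j)`: part Γ-a with the slice majorants
  have hper : ∀ (π : Equiv.Perm (Fin m)) (j : Fin m → Fin K),
      graphValLS ω src tgt (fun ℓ => P ℓ (j ℓ)) vtx p ≤ B * sliceProd L K (orderExps dV e π (cert π)) (j ∘ ⇑π) := by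
    intro π j
    have h := graphValLS_le_of_forestCert (cert π) vtx hω (fun ℓ => P ℓ (j ℓ)) (fun ℓ => hP0 ℓ _) p hp0
      (fun ℓ => Cst * ((L : ℝ) ^ ((j ℓ : ℕ)) * eps L K) ^ e ℓ) (fun ℓ _ x y => hsup ℓ _ x y)
      (fun i => Cst * cV * ((L : ℝ) ^ ((j ((cert π).tl i) : ℕ)) * eps L K) ^ (e ((cert π).tl i) + dV))
      (fun i y => hrow _ _ y) (fun i y => hcol _ _ y) υ₀ hυ₀ hΓ q hq
    rw [lineConstants_eq L K (cert π) π Cst cV dV e j] at h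
    refine h.trans (le_of_eq ?_)
    rw [hB]; ring
  -- (3.58): orderings
  have hG0 : ∀ j : Fin m → Fin K, 0 ≤ graphValLS ω src tgt (fun ℓ => P ℓ (j ℓ)) vtx p := fun j =>
    graphValLS_nonneg' src tgt vtx hω _ (fun ℓ => hP0 ℓ _) p hp0
  refine (sum_le_sum_perm_monotone (β := Fin K) _ hG0).trans ?_
  have hdc : ∀ π : Equiv.Perm (Fin m),
      ∑ j : Fin m → Fin K, (if Monotone (j ∘ ⇑π) then graphValLS ω src tgt (fun ℓ => P ℓ (j ℓ)) vtx p else 0)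
        ≤ B * degConst L (orderList dV e π (cert π)) := by
    intro π
    calc ∑ j : Fin m → Fin K, (if Monotone (j ∘ ⇑π) then graphValLS ω src tgt (fun ℓ => P ℓ (j ℓ)) vtx p else 0)
        ≤ ∑ j : Fin m → Fin K, (if Monotone (j ∘ ⇑π) then B * sliceProd L K (orderExps dV e π (cert π)) (j ∘ ⇑π) else 0) := by
          refine sum_le_sum fun j _ => ?_
          split_ifs
          · exact hper π j
          · exact le_rfl
      _ = B * ∑ j : Fin m → Fin K, (if Monotone j then sliceProd L K (orderExps dV e π (cert π)) j else 0) := by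
          rw [mul_sum, ← sum_comp_perm_eq π (fun j : Fin m → Fin K => B * (if Monotone j then sliceProd L K (orderExps dV e π (cert π)) j else 0))]
          refine sum_congr rfl fun j _ => ?_
          split_ifs <;> simp
      _ = B * nestedSliceSum L K (orderList dV e π (cert π)) (K - 1) := by
          rw [sum_monotone_sliceProd_eq_top L hK]; rfl
      _ ≤ B * degConst L (orderList dV e π (cert π)) :=
          mul_le_mul_of_nonneg_left (nestedSliceSum_le_degConst L hL K (hpos π) (by omega)) hB0
  refine (sum_le_sum fun π _ => hdc π).trans (le_of_eq ?_)
  rw [← mul_sum, hB]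
  ring

end Assembly

end Summit.QuantumFields.YangMills.BalabanUVNodes.N15KingModelRung.Curved

end
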